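import Mathlib.LinearAlgebra.PiTensorProduct.Basic
import HarnessLib

/-!
# Semilinear functoriality of tensor powers / `PiTensorProduct`

Topic `LinearAlgebra/Semilinear`. For a ring homomorphism `σ : R → S`, `R`-modules `V i` and
`S`-modules `W i` (`i ∈ ι`, any index type) and `σ`-SEMILINEAR maps `f i : V i → W i`, the map
`⊗ᵢ vᵢ ↦ ⊗ᵢ fᵢ(vᵢ)` extends uniquely to a `σ`-semilinear map
`⨂[R] i, V i → ⨂[S] i, W i` (Mathlib's `PiTensorProduct.map` is the case `σ = id`). The
construction is the standard one: `(vᵢ)ᵢ ↦ ⊗ᵢ fᵢ(vᵢ)` is `R`-multilinear into the `S`-module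
`⨂[S] i, W i` with scalars RESTRICTED along `σ` (`c • w := σ c • w`), so Mathlib's universal
property `PiTensorProduct.lift` applies (Bourbaki, *Algebra* I, Ch. II §3 no. 9 / §5 no. 1:
extension of scalars and functoriality of tensor products in semilinear maps). Everything is
proved; Mathlib only; no named fact.

Used downstream for the `σ`-semilinear action of `Aut(ℂ)` (coordinatewise on `ℂⁿ`) on the tensor
powers `(ℂⁿ)^{⊗d}` and on the Weyl modules inside them — the rational structure of the algebraic
coefficient systems of arithmetic cohomology (Clozel 1990, §3.5).

## Main definitions and results

* `Literature.LinearAlgebra.Semilinear.PiTensorProduct.semimap f :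
    (⨂[R] i, V i) →ₛₗ[σ] ⨂[S] i, W i`, with `semimap_tprod` (`semimap f (⊗ v) = ⊗ f v`);
* `PiTensorProduct.semilinear_ext` — two `σ`-semilinear maps out of `⨂[R] i, V i` that agree on
  pure tensors are equal;
* `semimap_map` (compatibility with Mathlib's linear `PiTensorProduct.map`:
  `semimap f₂ ∘ map g = map g' ∘ semimap f` when `f₂ᵢ ∘ gᵢ = g'ᵢ ∘ fᵢ`), `semimap_reindex`
  (compatibility with `PiTensorProduct.reindex` for a constant family), `semimap_semimap`
  (composition), `semimap_semimap_of_leftInverse` / `semimap_injective_of_leftInverse`,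
  `semimap_eq_self` (identity), `semimap_eq_map` (linear case = `PiTensorProduct.map`).

## References

* N. Bourbaki, *Algebra I*, Ch. II, §3 no. 9 and §5 no. 1 (tensor products, change of rings,
  functoriality). [folklore]
* L. Clozel, *Motifs et formes automorphes*, in: Automorphic forms, Shimura varieties, and
  L-functions I (1990), §3.5. [Clozel1990]
-/

noncomputable section

open scoped TensorProduct

namespace Literature.LinearAlgebra.Semilinear

namespace PiTensorProduct

open _root_.PiTensorProduct

variable {ι : Type*} {R S : Type*} [CommSemiring R] [CommSemiring S] {σ : R →+* S}
  {V : ι → Type*} [∀ i, AddCommMonoid (V i)] [∀ i, Module R (V i)]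
  {W : ι → Type*} [∀ i, AddCommMonoid (W i)] [∀ i, Module S (W i)]

/-! ### Restriction of scalars along `σ` (a local type synonym) -/

/-- An `S`-module viewed as an `R`-module through `σ : R → S` (`c • m := σ c • m`); a type
synonym local to this construction (Mathlib's `RestrictScalars` wants an `Algebra R S` instance).
[folklore] -/
def Twist (_σ : R →+* S) (M : Type*) : Type _ := M

namespace Twist

variable (σ) (M : Type*)

/-- The additive structure of `Twist σ M` is that of `M`. [folklore] -/
instance [AddCommMonoid M] : AddCommMonoid (Twist σ M) := inferInstanceAs (AddCommMonoid M)

/-- The `R`-module structure `c • m := σ c • m`. [folklore] -/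
instance [AddCommMonoid M] [Module S M] : Module R (Twist σ M) := Module.compHom M σ

/-- The identity `M → Twist σ M`. [folklore] -/
def toTwist : M → Twist σ M := id

/-- The identity `Twist σ M → M`. [folklore] -/
def ofTwist : Twist σ M → M := id

variable {σ M}

/-- `ofTwist` is additive. [folklore] -/
theorem ofTwist_add [AddCommMonoid M] (x y : Twist σ M) :
    ofTwist σ M (x + y) = ofTwist σ M x + ofTwist σ M y := rfl

/-- `toTwist` is additive. [folklore] -/
theorem toTwist_add [AddCommMonoid M] (m m' : M) :
    toTwist σ M (m + m') = toTwist σ M m + toTwist σ M m' := rfl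

/-- The twisted scalar action, read in `M`: `c • x = σ c • x`. [folklore] -/
theorem ofTwist_smul [AddCommMonoid M] [Module S M] (c : R) (x : Twist σ M) :
    ofTwist σ M (c • x) = σ c • ofTwist σ M x := rfl

/-- The twisted scalar action, read in `Twist σ M`: `σ c • m = c • m`. [folklore] -/
theorem toTwist_smul [AddCommMonoid M] [Module S M] (c : R) (m : M) :
    toTwist σ M (σ c • m) = c • toTwist σ M m := rfl

end Twist

open Twist

/-! ### The semilinear map on `PiTensorProduct` -/

/-- `(vᵢ)ᵢ ↦ ⊗ᵢ fᵢ(vᵢ)` as an `R`-MULTILINEAR map into `⨂[S] i, W i` with scalars restricted along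
`σ`. [folklore] -/
def tprodSemi (f : ∀ i, V i →ₛₗ[σ] W i) : MultilinearMap R V (Twist σ (⨂[S] i, W i)) where
  toFun v := toTwist σ _ (tprod S fun i => f i (v i))
  map_update_add' v i x y := by
    classical
    rw [← toTwist_add]
    congr 1
    have h : (fun j => f j (Function.update v i (x + y) j)) =
        Function.update (fun j => f j (v j)) i (f i x + f i y) := by
      funext j
      by_cases hj : j = i
      · subst hj; simp
      · simp [hj]
    have hx : (fun j => f j (Function.update v i x j)) =
        Function.update (fun j => f j (v j)) i (f i x) := by
      funext j
      by_cases hj : j = i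
      · subst hj; simp
      · simp [hj]
    have hy : (fun j => f j (Function.update v i y j)) =
        Function.update (fun j => f j (v j)) i (f i y) := by
      funext j
      by_cases hj : j = i
      · subst hj; simp
      · simp [hj]
    rw [h, hx, hy, MultilinearMap.map_update_add]
  map_update_smul' v i c x := by
    classical
    rw [← toTwist_smul]
    congr 1
    have h : (fun j => f j (Function.update v i (c • x) j)) =
        Function.update (fun j => f j (v j)) i (σ c • f i x) := by
      funext j
      by_cases hj : j = i
      · subst hj; simp [map_smulₛₗ]
      · simp [hj]
    have hx : (fun j => f j (Function.update v i x j)) =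
        Function.update (fun j => f j (v j)) i (f i x) := by
      funext j
      by_cases hj : j = i
      · subst hj; simp
      · simp [hj]
    rw [h, hx, MultilinearMap.map_update_smul]

/-- **Semilinear functoriality of `PiTensorProduct`**: for `σ`-semilinear `fᵢ : Vᵢ → Wᵢ` the
`σ`-semilinear map `⨂[R] i, V i → ⨂[S] i, W i`, `⊗ᵢ vᵢ ↦ ⊗ᵢ fᵢ(vᵢ)` (Bourbaki, Alg. II §3.9,
§5.1). [folklore] -/
def semimap (f : ∀ i, V i →ₛₗ[σ] W i) : (⨂[R] i, V i) →ₛₗ[σ] ⨂[S] i, W i where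
  toFun x := ofTwist σ _ (lift (tprodSemi f) x)
  map_add' x y := by
    rw [map_add, ofTwist_add]
  map_smul' c x := by
    rw [LinearMap.map_smul, ofTwist_smul]

/-- **`semimap f (⊗ᵢ vᵢ) = ⊗ᵢ fᵢ(vᵢ)`.** [folklore] -/
@[simp]
theorem semimap_tprod (f : ∀ i, V i →ₛₗ[σ] W i) (v : ∀ i, V i) :
    semimap f (tprod R v) = tprod S fun i => f i (v i) := by
  change ofTwist σ _ (lift (tprodSemi f) (tprod R v)) = _
  rw [lift.tprod]
  rfl

/-- **Uniqueness**: two `σ`-semilinear maps out of `⨂[R] i, V i` (into any `S`-module) that agree on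
pure tensors are equal (pure tensors span). [folklore] -/
theorem semilinear_ext {N : Type*} [AddCommMonoid N] [Module S N]
    {g g' : (⨂[R] i, V i) →ₛₗ[σ] N} (h : ∀ v : ∀ i, V i, g (tprod R v) = g' (tprod R v)) :
    g = g' := by
  refine LinearMap.ext fun x => ?_
  induction x using PiTensorProduct.induction_on with
  | smul_tprod r v => rw [map_smulₛₗ, map_smulₛₗ, h]
  | add x y hx hy => rw [map_add, map_add, hx, hy]

/-- Pointwise form of `semilinear_ext`. [folklore] -/
theorem semilinear_ext_apply {N : Type*} [AddCommMonoid N] [Module S N]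
    {g g' : (⨂[R] i, V i) →ₛₗ[σ] N} (h : ∀ v : ∀ i, V i, g (tprod R v) = g' (tprod R v))
    (x : ⨂[R] i, V i) : g x = g' x := by
  rw [semilinear_ext h]

/-! ### Compatibilities -/

section Compat

variable {V₂ : ι → Type*} [∀ i, AddCommMonoid (V₂ i)] [∀ i, Module R (V₂ i)]
  {W₂ : ι → Type*} [∀ i, AddCommMonoid (W₂ i)] [∀ i, Module S (W₂ i)]

/-- **Compatibility with Mathlib's linear functoriality**: if `f₂ᵢ ∘ gᵢ = g'ᵢ ∘ fᵢ` for `R`-linear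
`gᵢ : Vᵢ → V₂ᵢ` and `S`-linear `g'ᵢ : Wᵢ → W₂ᵢ`, then
`semimap f₂ ∘ map g = map g' ∘ semimap f`. (E.g. `gᵢ = g'ᵢ =` multiplication by a matrix `h`,
resp. by `σ(h)`: the coordinatewise `Aut(ℂ)`-action on `(ℂⁿ)^{⊗d}` intertwines `h^{⊗d}` and
`σ(h)^{⊗d}`.) [folklore] -/
theorem semimap_map (f : ∀ i, V i →ₛₗ[σ] W i) (f₂ : ∀ i, V₂ i →ₛₗ[σ] W₂ i)
    (g : ∀ i, V i →ₗ[R] V₂ i) (g' : ∀ i, W i →ₗ[S] W₂ i)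
    (h : ∀ i (v : V i), f₂ i (g i v) = g' i (f i v)) (x : ⨂[R] i, V i) :
    semimap f₂ (map g x) = map g' (semimap f x) := by
  refine semilinear_ext_apply (g := (semimap f₂).comp (map g)) (g' := (map g').comp (semimap f))
    (fun v => ?_) x
  simp [h]

/-- **Composition**: `semimap f' (semimap f x) = semimap t x` whenever `tᵢ = f'ᵢ ∘ fᵢ`, for a
third ring `T`, `σ' : S → T` and `τ = σ' ∘ σ` (given pointwise). [folklore] -/
theorem semimap_semimap {T : Type*} [CommSemiring T] {σ' : S →+* T} {τ : R →+* T}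
    {X : ι → Type*} [∀ i, AddCommMonoid (X i)] [∀ i, Module T (X i)]
    (f : ∀ i, V i →ₛₗ[σ] W i) (f' : ∀ i, W i →ₛₗ[σ'] X i) (t : ∀ i, V i →ₛₗ[τ] X i)
    (hστ : ∀ r, τ r = σ' (σ r)) (h : ∀ i (v : V i), t i v = f' i (f i v)) (x : ⨂[R] i, V i) :
    semimap f' (semimap f x) = semimap t x := by
  induction x using PiTensorProduct.induction_on with
  | smul_tprod r v =>
    rw [map_smulₛₗ, map_smulₛₗ, map_smulₛₗ, semimap_tprod, semimap_tprod, semimap_tprod, hστ]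
    congr 1
    exact congrArg (tprod T) (funext fun i => (h i (v i)).symm)
  | add x y hx hy => rw [map_add, map_add, map_add, hx, hy]

/-- **Left inverses**: if `f'ᵢ (fᵢ v) = v` for all `i`, `v` (with `σ' ∘ σ = id` pointwise), then
`semimap f' ∘ semimap f = id`; in particular `semimap f` is injective. [folklore] -/
theorem semimap_semimap_of_leftInverse {σ' : S →+* R} (f : ∀ i, V i →ₛₗ[σ] W i)
    (f' : ∀ i, W i →ₛₗ[σ'] V i) (hσ : ∀ r, σ' (σ r) = r) (h : ∀ i (v : V i), f' i (f i v) = v)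
    (x : ⨂[R] i, V i) : semimap f' (semimap f x) = x := by
  induction x using PiTensorProduct.induction_on with
  | smul_tprod r v =>
    rw [map_smulₛₗ, map_smulₛₗ, semimap_tprod, semimap_tprod, hσ]
    congr 1
    exact congrArg (tprod R) (funext fun i => h i (v i))
  | add x y hx hy => rw [map_add, map_add, hx, hy]

/-- A family with semilinear left inverses induces an injective `semimap`. [folklore] -/
theorem semimap_injective_of_leftInverse {σ' : S →+* R} (f : ∀ i, V i →ₛₗ[σ] W i)
    (f' : ∀ i, W i →ₛₗ[σ'] V i) (hσ : ∀ r, σ' (σ r) = r) (h : ∀ i (v : V i), f' i (f i v) = v) :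
    Function.Injective (semimap f) :=
  Function.LeftInverse.injective (g := semimap f') fun x => semimap_semimap_of_leftInverse f f' hσ h x

/-- **Identity**: for `R`-LINEAR `fᵢ` (`σ = id`) equal to the identity maps, `semimap f = id`
(and in general `semimap f = PiTensorProduct.map f` for linear `fᵢ`, `semimap_eq_map`). [folklore] -/
theorem semimap_eq_self (f : ∀ i, V i →ₗ[R] V i) (h : ∀ i (v : V i), f i v = v)
    (x : ⨂[R] i, V i) : semimap f x = x := by
  induction x using PiTensorProduct.induction_on with
  | smul_tprod r v =>
    rw [map_smulₛₗ, semimap_tprod, RingHom.id_apply]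
    congr 1
    exact congrArg (tprod R) (funext fun i => h i (v i))
  | add x y hx hy => rw [map_add, hx, hy]

/-- For `R`-linear `fᵢ`, `semimap f` is Mathlib's `PiTensorProduct.map f`. [folklore] -/
theorem semimap_eq_map (f : ∀ i, V i →ₗ[R] V₂ i) (x : ⨂[R] i, V i) :
    semimap f x = map f x := by
  induction x using PiTensorProduct.induction_on with
  | smul_tprod r v => rw [map_smulₛₗ, map_smul, semimap_tprod, map_tprod, RingHom.id_apply]
  | add x y hx hy => rw [map_add, map_add, hx, hy]

/-- **Compatibility with `reindex`** (constant family `Vᵢ = M`, `Wᵢ = N`, one semilinear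
`f₀ : M → N` in every slot): `semimap` commutes with permuting the tensor factors,
`semimap f₀ (reindex e x) = reindex e (semimap f₀ x)`. (E.g. the coordinatewise `Aut(ℂ)`-action on
`M^{⊗d}` commutes with the action of `S_d`.) [folklore] -/
theorem semimap_reindex {ι₂ : Type*} {M : Type*} [AddCommMonoid M] [Module R M] {N : Type*}
    [AddCommMonoid N] [Module S N] (f₀ : M →ₛₗ[σ] N) (e : ι ≃ ι₂) (x : ⨂[R] _ : ι, M) :
    semimap (fun _ : ι₂ => f₀) (reindex R (fun _ : ι => M) e x) =
      reindex S (fun _ : ι => N) e (semimap (fun _ : ι => f₀) x) := by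
  induction x using PiTensorProduct.induction_on with
  | smul_tprod r v =>
    rw [LinearEquiv.map_smul, map_smulₛₗ, map_smulₛₗ, LinearEquiv.map_smul, reindex_tprod,
      semimap_tprod, semimap_tprod, reindex_tprod]
  | add x y hx hy => rw [map_add, map_add, map_add, map_add, hx, hy]

end Compat

end PiTensorProduct

end Literature.LinearAlgebra.Semilinear

end
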